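import Summits.QuantumFields.YangMills.Theorems.BalabanUVNodesN15CurvedGluingCubeSmoothCutDressedDefect
import Summits.QuantumFields.YangMills.Theorems.BalabanUVNodesN15CurvedGluingCubeDressedGeneralLeftFactors
import HarnessLib

/-!
# Route «BalabanUVNodes» (cluster K4 «SpineRates»), Track-A DAG node N15 = NE2, BACKGROUND LAYER — LEFT FACTORS OF THE DRESSED SMOOTH-CUT CUBE BY NAME: file 30's resolvent-factoring rows
# `T∘X = (T∘G₀)(1 + V̂X̂)` run at `G₀ := M_{χ̃}N_□` (one and two grids) — FILE 58's ENTRY-3 family `hG3`∕`hK3′` (any left factor `T`, e.g. FILE 54's `D₃` or `[D₃, M_h]`) and `hIG3`∕`hDK3` from the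
# flat rows `T∘(M_χ̃N_□)`, their defects, FILE 63's cut rows and the bumps

Cell `pub-ymgap`, seat `pub-ymgap-dag-n15-w3` (WIDTH SEAT 3∕3 on node N15, director-ym №197 ∕ HUMAN RULING D-0149; plan `W-SEAT-START-LIST.md` §n15 item 3 «LG-vector + background layers at
GENERAL small-field U» — fortieth piece).  `bears_on: R4∕N15 · K3⁷ SpineGivenEndpointR13SepCoPH (stmt-QuantumFields-20544)`.  Filed `--kind proof --supports stmt-QuantumFields-20544 --as helper` —
COUNT-NEUTRAL.  Theorems only; 0 `sorry`.  Imports BY NAME file 35 `…SmoothCutDressedDefect` (files 34∕31 rows and cut-offs) and file 30 `…CubeDressedGeneralLeftFactors` (`hasMaj_comp_dressedV_loc₂`,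
`hasMaj_idef_comp_dressedV_loc₂_of`; file 23 `hasMaj_dressedV_pair`, file 24 `hasMaj_idef_dressedV_pair`); nothing in the tree is modified.

WHY.  The last FILE 58 row family for the dressed smooth-cut cube: entry 3 `D₃∘X` and the row `[D₃, M_h]∘X` (FILE 54: ANY operator `D₃`), with their two-grid defects.  File 30 reduces them to
the FLAT rows `T∘G₀` for `T ∈ {D₃, [D₃, M_h]}`; at `G₀ = M_χ̃N_□` those flat rows (`T∘(M_χ̃N_□) ≤ 1_S1_S·te^{−δd}`, output cut-off `M_χ∘T∘(M_χ̃N_□) = T∘(M_χ̃N_□)`, two-grid defect `≤ 1_S1_S·m_Te^{−δd}`)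
stay DISPLAYED (for `D₃ = Σ∇*∇ + W` they are FILE 63 `hasMaj_commOp_lapOp_comp_of_cut` at `h := χ̃` plus the second-order cut rows — the knit's `D₃` of record decides), everything else is
files 31∕34∕35.  ★★ `hasMaj_comp_smoothCutDressed_loc₂` (one grid), ★★ `hasMaj_idef_comp_smoothCutDressed_loc₂` (two grids; pair letters BY NAME from files 23∕24 at `β̄, m̄`).

HONEST FRAMING ∕ LIMITS.  Pure instantiation over DISPLAYED rows; nothing of [B6]∕[B9] asserted ((2.133)–(2.134) p.247, (3.42) p.397 (entry 3), (3.63)–(3.65), Thm 3.14 = SHAPES ∕ MECHANISM ∕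
TEMPLATE).  NE2⁺ NOT PRINTED, NOT proved; N15 NOT discharged; counts of record UNMOVED (typed 28∕28 · discharged 5∕27); one finite 𝕋⁴ at fixed ε — NOT infinite volume, NOT OS on ℝ⁴, NOT a
mass gap, NOT Clay; R4 closes the conditional finite-𝕋⁴ rung `BalabanLadder.UV` only.
-/

set_option autoImplicit false

noncomputable section
open scoped BigOperators
open Finset

namespace Summit.QuantumFields.YangMills.BalabanUVNodes.N15.CurvedSpecies

open Literature.MathematicalPhysics.QuantumFieldTheory.Balaban1983to89
open Literature.MathematicalPhysics.QuantumFieldTheory.Balaban1983to89.B11SectG (BlockNorm HasMaj RowSum)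
open Literature.MathematicalPhysics.QuantumFieldTheory.Balaban1983to89.B6RandomWalk (Triangle254)
open Literature.MathematicalPhysics.QuantumFieldTheory.Balaban1983to89.T4EtaRateDefect (idef)
open Literature.MathematicalPhysics.QuantumFieldTheory.Balaban1983to89.T4EtaRateCoeffDefect (pull)
open Literature.MathematicalPhysics.QuantumFieldTheory.Balaban1983to89.B6Prop26Gluing (mulOp mulOp_apply ind ind_nonneg)
open Summit.QuantumFields.YangMills.BalabanUVNodes.N15.MatrixSpecies (liftBlk liftMap liftEquiv liftEquiv_apply liftEquiv_symm_apply)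
open Summit.QuantumFields.YangMills.BalabanUVNodes.N15.BackgroundLayer (fgrad bgrad stack projO blkPair liftPair bgPropV projO_none_comp_stack)

variable {X X' ι J : Type} [Fintype X] [Fintype X'] [DecidableEq X] [DecidableEq X'] [Fintype ι] [DecidableEq ι] [Fintype J] [DecidableEq J] {g : B6.Geometry}
  (blk : X → g.Site) (π : X' → X) (τ : J → X ≃ X) (τ' : J → X' ≃ X') (n n' : ℝ) {σ cr : ℝ}
  {N : (X × ι → ℝ) →ₗ[ℝ] (X × ι → ℝ)} {N' : (X' × ι → ℝ) →ₗ[ℝ] (X' × ι → ℝ)} {V : ((X × ι) × Option (J ⊕ J) → ℝ) →ₗ[ℝ] (X × ι → ℝ)}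
  {V' : ((X' × ι) × Option (J ⊕ J) → ℝ) →ₗ[ℝ] (X' × ι → ℝ)} {χX χtX ψX : X → ℝ} {χX' χtX' ψX' : X' → ℝ} {S : Set g.Site} {β β₁ ct m₀ m₁ oχ o₁ o₂ δ : ℝ}

omit [Fintype X'] [DecidableEq X'] in
/-- ★★ **A LEFT FACTOR OF THE DRESSED SMOOTH-CUT CUBE, TWO-SIDED** (FILE 58 `hG3` at `T := D₃`, `hK3′` at `T := [D₃, M_h]`): coarse smooth-cut data (cut rows `β, β₁`, bump, insertions, `N = NM_ψ`), the flat
row `T∘(M_χ̃N) ≤ te^{−δd}` with output cut-off `M_χ∘T∘(M_χ̃N) = T∘(M_χ̃N)`, `V̂ ≤ Re^{−δ_Vd}`, `β̄Rc_r² < 1` ⟹ `T∘X ≤ 1_S1_S·t(1 − β̄Rc_r²)⁻¹e^{−ρ₂d}`.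
[cite: Balaban1985BackgroundPropagators, (3.42) p.397 (entry 3), (3.63)–(3.65) pp.402–403 (mechanism); Balaban1984PropagatorsII, (2.133)–(2.134) p.247] -/
theorem hasMaj_comp_smoothCutDressed_loc₂ (htri : Triangle254 g) (hd : ∀ a b : g.Site, 0 ≤ g.dist a b) (hrow : RowSum g σ cr) (hσ : 0 ≤ σ) {ρ₁ ρ₂ δV R t : ℝ} (hβ : 0 ≤ β)
    (hβ₁ : 0 ≤ β₁) (hct : 0 ≤ ct) (hR : 0 ≤ R) (ht : 0 ≤ t) (hcr : 0 ≤ cr) (hσρ : σ ≤ ρ₁) (hρ₁V : ρ₁ ≤ δV) (hρ₁G : ρ₁ + σ ≤ δ) (hρ₂ : 0 ≤ ρ₂) (hρ₂₁ : ρ₂ + σ ≤ ρ₁)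
    (T : (X × ι → ℝ) →ₗ[ℝ] (X × ι → ℝ))
    (hSχ : ∀ x, χX x ≠ 0 → blk x ∈ S) (hSψ : ∀ x, ψX x ≠ 0 → blk x ∈ S) (hχt : ∀ x, |χtX x| ≤ 1)
    (hdχt : ∀ μ p, |fgrad n (liftEquiv (τ μ) ι) (fun p : X × ι => χtX p.1) p| ≤ ct) (hdχtb : ∀ μ p, |bgrad n (liftEquiv (τ μ) ι) (fun p : X × ι => χtX p.1) p| ≤ ct)
    (hsub : mulOp (fun p : X × ι => χtX p.1) ∘ₗ mulOp (fun p : X × ι => χX p.1) = mulOp (fun p : X × ι => χtX p.1))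
    (hs : ∀ μ, mulOp ((fun p : X × ι => χtX p.1) ∘ (liftEquiv (τ μ) ι)) ∘ₗ mulOp (fun p : X × ι => χX p.1) = mulOp ((fun p : X × ι => χtX p.1) ∘ (liftEquiv (τ μ) ι)))
    (hsb : ∀ μ, mulOp ((fun p : X × ι => χtX p.1) ∘ (liftEquiv (τ μ) ι).symm) ∘ₗ mulOp (fun p : X × ι => χX p.1) = mulOp ((fun p : X × ι => χtX p.1) ∘ (liftEquiv (τ μ) ι).symm))
    (hdd : ∀ μ, mulOp (fgrad n (liftEquiv (τ μ) ι) (fun p : X × ι => χtX p.1)) ∘ₗ mulOp (fun p : X × ι => χX p.1) = mulOp (fgrad n (liftEquiv (τ μ) ι) (fun p : X × ι => χtX p.1)))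
    (hddb : ∀ μ, mulOp (bgrad n (liftEquiv (τ μ) ι) (fun p : X × ι => χtX p.1)) ∘ₗ mulOp (fun p : X × ι => χX p.1) = mulOp (bgrad n (liftEquiv (τ μ) ι) (fun p : X × ι => χtX p.1)))
    (hNψ : N ∘ₗ mulOp (fun p : X × ι => ψX p.1) = N)
    (hcut : HasMaj (BlockNorm.ofBlocks g (liftBlk blk ι)) (BlockNorm.ofBlocks g (liftBlk blk ι)) (mulOp (fun p : X × ι => χX p.1) ∘ₗ N)
      (fun y y' => ind S y * ind S y' * (β * Real.exp (-(δ * g.dist y y')))))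
    (hcutF : ∀ μ, HasMaj (BlockNorm.ofBlocks g (liftBlk blk ι)) (BlockNorm.ofBlocks g (liftBlk blk ι)) (mulOp (fun p : X × ι => χX p.1) ∘ₗ (fgrad n (liftEquiv (τ μ) ι) ∘ₗ N))
      (fun y y' => ind S y * ind S y' * (β₁ * Real.exp (-(δ * g.dist y y')))))
    (hcutB : ∀ μ, HasMaj (BlockNorm.ofBlocks g (liftBlk blk ι)) (BlockNorm.ofBlocks g (liftBlk blk ι)) (mulOp (fun p : X × ι => χX p.1) ∘ₗ (bgrad n (liftEquiv (τ μ) ι) ∘ₗ N))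
      (fun y y' => ind S y * ind S y' * (β₁ * Real.exp (-(δ * g.dist y y')))))
    (hV : HasMaj (BlockNorm.ofBlocks g (blkPair (liftBlk blk ι))) (BlockNorm.ofBlocks g (liftBlk blk ι)) V (fun y y' => R * Real.exp (-(δV * g.dist y y'))))
    (hq : (β + (β₁ + ct * β)) * (R * cr) * cr < 1)
    (hTχ : mulOp (fun p : X × ι => χX p.1) ∘ₗ (T ∘ₗ (mulOp (fun p : X × ι => χtX p.1) ∘ₗ N)) = T ∘ₗ (mulOp (fun p : X × ι => χtX p.1) ∘ₗ N))
    (hTG : HasMaj (BlockNorm.ofBlocks g (liftBlk blk ι)) (BlockNorm.ofBlocks g (liftBlk blk ι)) (T ∘ₗ (mulOp (fun p : X × ι => χtX p.1) ∘ₗ N)) (fun y y' => t * Real.exp (-(δ * g.dist y y')))) :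
    HasMaj (BlockNorm.ofBlocks g (liftBlk blk ι)) (BlockNorm.ofBlocks g (liftBlk blk ι)) (T ∘ₗ (projO none ∘ₗ bgPropV (stack (mulOp (fun p : X × ι => χtX p.1) ∘ₗ N)
        (fun j => Sum.elim (fun μ => fgrad n (liftEquiv (τ μ) ι)) (fun μ => bgrad n (liftEquiv (τ μ) ι)) j ∘ₗ (mulOp (fun p : X × ι => χtX p.1) ∘ₗ N))) V))
      (fun y y' => ind S y * ind S y' * (t * (1 - (β + (β₁ + ct * β)) * (R * cr) * cr)⁻¹ * Real.exp (-(ρ₂ * g.dist y y')))) := by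
  have hβb : 0 ≤ β + (β₁ + ct * β) := by positivity
  have hG := hasMaj_smoothCut_flat blk (S := S) hβ hβ₁ hct hχt hsub hcut
  have hD := hasMaj_jet_smoothCut_flat blk τ n (S := S) hβ hβ₁ hct hχt hdχt hdχtb hs hsb hdd hddb hcut hcutF hcutB
  exact hasMaj_comp_dressedV_loc₂ blk htri hd hrow hσ hβb hR ht hcr hσρ hρ₁V hρ₁G hρ₂ hρ₂₁ (fun _ => rfl) T hSχ hSψ hTχ (smoothCut_in hNψ) hG hD hV hq hTG

/-- ★★ **THE TWO-GRID DEFECT OF A LEFT FACTOR OF THE DRESSED SMOOTH-CUT CUBE, TWO-SIDED** (FILE 58 `hIG3`∕`hDK3`): both grids' smooth-cut data (cut rows + defects, bumps + fits, input cut-offs),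
the FINE flat row `T′∘(M_{χ̃′}N′) ≤ te^{−δd}`, the flat rows' defect `𝔇(T′∘(M_{χ̃′}N′), T∘(M_χ̃N)) ≤ m_Te^{−δd}`, both output cut-offs, `V̂, V̂′ ≤ Re^{−δ_Vd}`, fit `o`, `β̄Rc_r² < 1`, `ρ₂ + σ ≤ δ`
⟹ `𝔇(T′X′, TX) ≤ 1_S1_S·(t(RA_D + oA)c_r² + m_T(1 + RAc_r²))e^{−ρ₂d}` with the pair letters `A = β̄(1 − β̄Rc_r²)⁻¹`, `A_D` = file 24's constant at `β̄, m̄` BY NAME.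
[cite: Balaban1985BackgroundPropagators, Thm 3.14 pp.426–427 (template), (3.42) p.397 (entry 3); Balaban1984PropagatorsII, (2.133) p.247] -/
theorem hasMaj_idef_comp_smoothCutDressed_loc₂ (htri : Triangle254 g) (hd : ∀ a b : g.Site, 0 ≤ g.dist a b) (hrow : RowSum g σ cr) (hσ : 0 ≤ σ) (hcr : 0 ≤ cr) {ρ₁ ρ₂ δV R o t mT : ℝ}
    (hβ : 0 ≤ β) (hβ₁ : 0 ≤ β₁) (hct : 0 ≤ ct) (hm₀ : 0 ≤ m₀) (hm₁ : 0 ≤ m₁) (hoχ : 0 ≤ oχ) (ho₁ : 0 ≤ o₁) (ho₂ : 0 ≤ o₂) (hR : 0 ≤ R) (ho : 0 ≤ o) (ht : 0 ≤ t) (hmT : 0 ≤ mT)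
    (hσρ : σ ≤ ρ₁) (hρ₁V : ρ₁ ≤ δV) (hρ₁G : ρ₁ + σ ≤ δ) (hσρ₂ : σ ≤ ρ₂) (hρ₂₁ : ρ₂ + σ ≤ ρ₁)
    (T : (X × ι → ℝ) →ₗ[ℝ] (X × ι → ℝ)) (T' : (X' × ι → ℝ) →ₗ[ℝ] (X' × ι → ℝ))
    (hSχ : ∀ x, χX x ≠ 0 → blk x ∈ S) (hSψ : ∀ x, ψX x ≠ 0 → blk x ∈ S) (hSχ' : ∀ x', χX' x' ≠ 0 → blk (π x') ∈ S) (hSψ' : ∀ x', ψX' x' ≠ 0 → blk (π x') ∈ S)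
    -- coarse bump data
    (hχt : ∀ x, |χtX x| ≤ 1)
    (hdχt : ∀ μ p, |fgrad n (liftEquiv (τ μ) ι) (fun p : X × ι => χtX p.1) p| ≤ ct) (hdχtb : ∀ μ p, |bgrad n (liftEquiv (τ μ) ι) (fun p : X × ι => χtX p.1) p| ≤ ct)
    (hsub : mulOp (fun p : X × ι => χtX p.1) ∘ₗ mulOp (fun p : X × ι => χX p.1) = mulOp (fun p : X × ι => χtX p.1))
    (hs : ∀ μ, mulOp ((fun p : X × ι => χtX p.1) ∘ (liftEquiv (τ μ) ι)) ∘ₗ mulOp (fun p : X × ι => χX p.1) = mulOp ((fun p : X × ι => χtX p.1) ∘ (liftEquiv (τ μ) ι)))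
    (hsb : ∀ μ, mulOp ((fun p : X × ι => χtX p.1) ∘ (liftEquiv (τ μ) ι).symm) ∘ₗ mulOp (fun p : X × ι => χX p.1) = mulOp ((fun p : X × ι => χtX p.1) ∘ (liftEquiv (τ μ) ι).symm))
    (hdd : ∀ μ, mulOp (fgrad n (liftEquiv (τ μ) ι) (fun p : X × ι => χtX p.1)) ∘ₗ mulOp (fun p : X × ι => χX p.1) = mulOp (fgrad n (liftEquiv (τ μ) ι) (fun p : X × ι => χtX p.1)))
    (hddb : ∀ μ, mulOp (bgrad n (liftEquiv (τ μ) ι) (fun p : X × ι => χtX p.1)) ∘ₗ mulOp (fun p : X × ι => χX p.1) = mulOp (bgrad n (liftEquiv (τ μ) ι) (fun p : X × ι => χtX p.1)))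
    (hNψ : N ∘ₗ mulOp (fun p : X × ι => ψX p.1) = N)
    -- fine bump data
    (hχt' : ∀ x', |χtX' x'| ≤ 1)
    (hdχt' : ∀ μ p', |fgrad n' (liftEquiv (τ' μ) ι) (fun p' : X' × ι => χtX' p'.1) p'| ≤ ct) (hdχtb' : ∀ μ p', |bgrad n' (liftEquiv (τ' μ) ι) (fun p' : X' × ι => χtX' p'.1) p'| ≤ ct)
    (hsub' : mulOp (fun p : X' × ι => χtX' p.1) ∘ₗ mulOp (fun p : X' × ι => χX' p.1) = mulOp (fun p : X' × ι => χtX' p.1))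
    (hs' : ∀ μ, mulOp ((fun p' : X' × ι => χtX' p'.1) ∘ (liftEquiv (τ' μ) ι)) ∘ₗ mulOp (fun p' : X' × ι => χX' p'.1) = mulOp ((fun p' : X' × ι => χtX' p'.1) ∘ (liftEquiv (τ' μ) ι)))
    (hsb' : ∀ μ, mulOp ((fun p' : X' × ι => χtX' p'.1) ∘ (liftEquiv (τ' μ) ι).symm) ∘ₗ mulOp (fun p' : X' × ι => χX' p'.1) =
      mulOp ((fun p' : X' × ι => χtX' p'.1) ∘ (liftEquiv (τ' μ) ι).symm))
    (hdd' : ∀ μ, mulOp (fgrad n' (liftEquiv (τ' μ) ι) (fun p' : X' × ι => χtX' p'.1)) ∘ₗ mulOp (fun p' : X' × ι => χX' p'.1) = mulOp (fgrad n' (liftEquiv (τ' μ) ι) (fun p' : X' × ι => χtX' p'.1)))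
    (hddb' : ∀ μ, mulOp (bgrad n' (liftEquiv (τ' μ) ι) (fun p' : X' × ι => χtX' p'.1)) ∘ₗ mulOp (fun p' : X' × ι => χX' p'.1) = mulOp (bgrad n' (liftEquiv (τ' μ) ι) (fun p' : X' × ι => χtX' p'.1)))
    (hNψ' : N' ∘ₗ mulOp (fun p : X' × ι => ψX' p.1) = N')
    -- fits of the bumps across `π`
    (hfitχ : ∀ x', |χtX' x' - χtX (π x')| ≤ oχ)
    (hfit₁ : ∀ μ p', |((fun p' : X' × ι => χtX' p'.1) ∘ (liftEquiv (τ' μ) ι)) p' - ((fun p : X × ι => χtX p.1) ∘ (liftEquiv (τ μ) ι)) (liftMap π ι p')| ≤ o₁)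
    (hfit₁b : ∀ μ p', |((fun p' : X' × ι => χtX' p'.1) ∘ (liftEquiv (τ' μ) ι).symm) p' - ((fun p : X × ι => χtX p.1) ∘ (liftEquiv (τ μ) ι).symm) (liftMap π ι p')| ≤ o₁)
    (hfit₂ : ∀ μ p', |fgrad n' (liftEquiv (τ' μ) ι) (fun p' : X' × ι => χtX' p'.1) p' - fgrad n (liftEquiv (τ μ) ι) (fun p : X × ι => χtX p.1) (liftMap π ι p')| ≤ o₂)
    (hfit₂b : ∀ μ p', |bgrad n' (liftEquiv (τ' μ) ι) (fun p' : X' × ι => χtX' p'.1) p' - bgrad n (liftEquiv (τ μ) ι) (fun p : X × ι => χtX p.1) (liftMap π ι p')| ≤ o₂)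
    -- cut rows and their defects
    (hcut : HasMaj (BlockNorm.ofBlocks g (liftBlk blk ι)) (BlockNorm.ofBlocks g (liftBlk blk ι)) (mulOp (fun p : X × ι => χX p.1) ∘ₗ N)
      (fun y y' => ind S y * ind S y' * (β * Real.exp (-(δ * g.dist y y')))))
    (hcutF : ∀ μ, HasMaj (BlockNorm.ofBlocks g (liftBlk blk ι)) (BlockNorm.ofBlocks g (liftBlk blk ι)) (mulOp (fun p : X × ι => χX p.1) ∘ₗ (fgrad n (liftEquiv (τ μ) ι) ∘ₗ N))
      (fun y y' => ind S y * ind S y' * (β₁ * Real.exp (-(δ * g.dist y y')))))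
    (hcutB : ∀ μ, HasMaj (BlockNorm.ofBlocks g (liftBlk blk ι)) (BlockNorm.ofBlocks g (liftBlk blk ι)) (mulOp (fun p : X × ι => χX p.1) ∘ₗ (bgrad n (liftEquiv (τ μ) ι) ∘ₗ N))
      (fun y y' => ind S y * ind S y' * (β₁ * Real.exp (-(δ * g.dist y y')))))
    (hcut' : HasMaj (BlockNorm.ofBlocks g (liftBlk (blk ∘ π) ι)) (BlockNorm.ofBlocks g (liftBlk (blk ∘ π) ι)) (mulOp (fun p : X' × ι => χX' p.1) ∘ₗ N')
      (fun y y' => ind S y * ind S y' * (β * Real.exp (-(δ * g.dist y y')))))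
    (hcutF' : ∀ μ, HasMaj (BlockNorm.ofBlocks g (liftBlk (blk ∘ π) ι)) (BlockNorm.ofBlocks g (liftBlk (blk ∘ π) ι)) (mulOp (fun p : X' × ι => χX' p.1) ∘ₗ (fgrad n' (liftEquiv (τ' μ) ι) ∘ₗ N'))
      (fun y y' => ind S y * ind S y' * (β₁ * Real.exp (-(δ * g.dist y y')))))
    (hcutB' : ∀ μ, HasMaj (BlockNorm.ofBlocks g (liftBlk (blk ∘ π) ι)) (BlockNorm.ofBlocks g (liftBlk (blk ∘ π) ι)) (mulOp (fun p : X' × ι => χX' p.1) ∘ₗ (bgrad n' (liftEquiv (τ' μ) ι) ∘ₗ N'))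
      (fun y y' => ind S y * ind S y' * (β₁ * Real.exp (-(δ * g.dist y y')))))
    (hDcut : HasMaj (BlockNorm.ofBlocks g (liftBlk blk ι)) (BlockNorm.ofBlocks g (liftBlk blk ι ∘ liftMap π ι))
      (idef (pull (liftMap π ι)) (pull (liftMap π ι)) (mulOp (fun p : X' × ι => χX' p.1) ∘ₗ N') (mulOp (fun p : X × ι => χX p.1) ∘ₗ N))
      (fun y y' => ind S y * ind S y' * (m₀ * Real.exp (-(δ * g.dist y y')))))
    (hDcutF : ∀ μ, HasMaj (BlockNorm.ofBlocks g (liftBlk blk ι)) (BlockNorm.ofBlocks g (liftBlk blk ι ∘ liftMap π ι))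
      (idef (pull (liftMap π ι)) (pull (liftMap π ι)) (mulOp (fun p : X' × ι => χX' p.1) ∘ₗ (fgrad n' (liftEquiv (τ' μ) ι) ∘ₗ N')) (mulOp (fun p : X × ι => χX p.1) ∘ₗ (fgrad n (liftEquiv (τ μ) ι) ∘ₗ N)))
      (fun y y' => ind S y * ind S y' * (m₁ * Real.exp (-(δ * g.dist y y')))))
    (hDcutB : ∀ μ, HasMaj (BlockNorm.ofBlocks g (liftBlk blk ι)) (BlockNorm.ofBlocks g (liftBlk blk ι ∘ liftMap π ι))
      (idef (pull (liftMap π ι)) (pull (liftMap π ι)) (mulOp (fun p : X' × ι => χX' p.1) ∘ₗ (bgrad n' (liftEquiv (τ' μ) ι) ∘ₗ N')) (mulOp (fun p : X × ι => χX p.1) ∘ₗ (bgrad n (liftEquiv (τ μ) ι) ∘ₗ N)))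
      (fun y y' => ind S y * ind S y' * (m₁ * Real.exp (-(δ * g.dist y y')))))
    (hV : HasMaj (BlockNorm.ofBlocks g (blkPair (liftBlk blk ι))) (BlockNorm.ofBlocks g (liftBlk blk ι)) V (fun y y' => R * Real.exp (-(δV * g.dist y y'))))
    (hV' : HasMaj (BlockNorm.ofBlocks g (blkPair (liftBlk (blk ∘ π) ι))) (BlockNorm.ofBlocks g (liftBlk (blk ∘ π) ι)) V' (fun y y' => R * Real.exp (-(δV * g.dist y y'))))
    (hDV : HasMaj (BlockNorm.ofBlocks g (blkPair (liftBlk blk ι))) (BlockNorm.ofBlocks g (liftBlk (blk ∘ π) ι))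
      (idef (pull (liftPair (liftMap π ι))) (pull (liftMap π ι)) V' V) (fun y y' => o * Real.exp (-(δV * g.dist y y'))))
    (hq : (β + (β₁ + ct * β)) * (R * cr) * cr < 1)
    (hTχ : mulOp (fun p : X × ι => χX p.1) ∘ₗ (T ∘ₗ (mulOp (fun p : X × ι => χtX p.1) ∘ₗ N)) = T ∘ₗ (mulOp (fun p : X × ι => χtX p.1) ∘ₗ N))
    (hTχ' : mulOp (fun p : X' × ι => χX' p.1) ∘ₗ (T' ∘ₗ (mulOp (fun p : X' × ι => χtX' p.1) ∘ₗ N')) = T' ∘ₗ (mulOp (fun p : X' × ι => χtX' p.1) ∘ₗ N'))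
    (hTG' : HasMaj (BlockNorm.ofBlocks g (liftBlk (blk ∘ π) ι)) (BlockNorm.ofBlocks g (liftBlk (blk ∘ π) ι)) (T' ∘ₗ (mulOp (fun p : X' × ι => χtX' p.1) ∘ₗ N')) (fun y y' => t * Real.exp (-(δ * g.dist y y'))))
    (hDTG : HasMaj (BlockNorm.ofBlocks g (liftBlk blk ι)) (BlockNorm.ofBlocks g (liftBlk (blk ∘ π) ι)) (idef (pull (liftMap π ι)) (pull (liftMap π ι)) (T' ∘ₗ (mulOp (fun p : X' × ι => χtX' p.1) ∘ₗ N')) (T ∘ₗ (mulOp (fun p : X × ι => χtX p.1) ∘ₗ N)))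
      (fun y y' => mT * Real.exp (-(δ * g.dist y y')))) :
    HasMaj (BlockNorm.ofBlocks g (liftBlk blk ι)) (BlockNorm.ofBlocks g (liftBlk (blk ∘ π) ι))
      (idef (pull (liftMap π ι)) (pull (liftMap π ι)) (T' ∘ₗ (projO none ∘ₗ bgPropV (stack (mulOp (fun p : X' × ι => χtX' p.1) ∘ₗ N')
        (fun j => Sum.elim (fun μ => fgrad n' (liftEquiv (τ' μ) ι)) (fun μ => bgrad n' (liftEquiv (τ' μ) ι)) j ∘ₗ (mulOp (fun p : X' × ι => χtX' p.1) ∘ₗ N'))) V')) (T ∘ₗ (projO none ∘ₗ bgPropV (stack (mulOp (fun p : X × ι => χtX p.1) ∘ₗ N)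
        (fun j => Sum.elim (fun μ => fgrad n (liftEquiv (τ μ) ι)) (fun μ => bgrad n (liftEquiv (τ μ) ι)) j ∘ₗ (mulOp (fun p : X × ι => χtX p.1) ∘ₗ N))) V)))
      (fun y y' => ind S y * ind S y' *
        ((t * (R * ((((m₀ + oχ * β) + (m₁ + o₁ * β₁ + ct * m₀ + o₂ * β)) * cr + 1 * (((m₀ + oχ * β) + (m₁ + o₁ * β₁ + ct * m₀ + o₂ * β)) * cr) * (R * ((β + (β₁ + ct * β)) * (1 - (β + (β₁ + ct * β)) * (R * cr) * cr)⁻¹) * cr)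
              + (β + (β₁ + ct * β)) * o * cr * ((β + (β₁ + ct * β)) * (1 - (β + (β₁ + ct * β)) * (R * cr) * cr)⁻¹) * cr) * (1 - 1 * ((β + (β₁ + ct * β)) * (R * cr) * cr))⁻¹)
              + o * ((β + (β₁ + ct * β)) * (1 - (β + (β₁ + ct * β)) * (R * cr) * cr)⁻¹)) * cr * cr
          + mT * (1 + R * ((β + (β₁ + ct * β)) * (1 - (β + (β₁ + ct * β)) * (R * cr) * cr)⁻¹) * cr * cr)) * Real.exp (-(ρ₂ * g.dist y y')))) := by
  have hβb : 0 ≤ β + (β₁ + ct * β) := by positivity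
  have hmb : 0 ≤ (m₀ + oχ * β) + (m₁ + o₁ * β₁ + ct * m₀ + o₂ * β) := by positivity
  have hρ₂ : 0 ≤ ρ₂ := hσ.trans hσρ₂
  have hρ₂V : ρ₂ + σ ≤ δV := by linarith
  have hρ₂δ : ρ₂ + σ ≤ δ := by linarith
  have hG := hasMaj_smoothCut_flat blk (S := S) hβ hβ₁ hct hχt hsub hcut
  have hD := hasMaj_jet_smoothCut_flat blk τ n (S := S) hβ hβ₁ hct hχt hdχt hdχtb hs hsb hdd hddb hcut hcutF hcutB
  have hG' := hasMaj_smoothCut_flat (blk ∘ π) (S := S) hβ hβ₁ hct hχt' hsub' hcut'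
  have hD' := hasMaj_jet_smoothCut_flat (blk ∘ π) τ' n' (S := S) hβ hβ₁ hct hχt' hdχt' hdχtb' hs' hsb' hdd' hddb' hcut' hcutF' hcutB'
  have hDG := hasMaj_idef_smoothCut_flat blk π (S := S) (N := N) (N' := N') hβ hβ₁ hct hm₀ hm₁ hoχ ho₁ ho₂ hχt' hfitχ hsub hsub' hcut hDcut
  have hDD := hasMaj_idef_jet_smoothCut_flat blk π τ τ' n n' (S := S) (N := N) (N' := N') hβ hβ₁ hct hm₀ hm₁ hoχ ho₁ ho₂ hχt' hdχt' hdχtb' hfit₁ hfit₁b hfit₂ hfit₂b hs hsb hdd hddb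
    hs' hsb' hdd' hddb' hcut hcutF hcutB hDcut hDcutF hDcutB
  obtain ⟨hunit, hX⟩ := hasMaj_dressedV_pair blk htri hd hrow hσ hβb hR hcr hσρ hρ₁V hρ₁G hρ₂ hρ₂₁ hG hD hV hq
  obtain ⟨hunit', -⟩ := hasMaj_dressedV_pair (blk ∘ π) htri hd hrow hσ hβb hR hcr hσρ hρ₁V hρ₁G hρ₂ hρ₂₁ hG' hD' hV' hq
  have hDX := hasMaj_idef_dressedV_pair blk π htri hd hrow hσ hcr hβb hR ho hmb hσρ hρ₁V hρ₁G hρ₂ hρ₂₁ hG hD hG' hD' hDG hDD hV hV' hDV hq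
  have hA : 0 ≤ (β + (β₁ + ct * β)) * (1 - (β + (β₁ + ct * β)) * (R * cr) * cr)⁻¹ := mul_nonneg hβb (inv_nonneg.2 (by linarith))
  have hAD : 0 ≤ (((m₀ + oχ * β) + (m₁ + o₁ * β₁ + ct * m₀ + o₂ * β)) * cr + 1 * (((m₀ + oχ * β) + (m₁ + o₁ * β₁ + ct * m₀ + o₂ * β)) * cr) * (R * ((β + (β₁ + ct * β)) * (1 - (β + (β₁ + ct * β)) * (R * cr) * cr)⁻¹) * cr) + (β + (β₁ + ct * β)) * o * cr * ((β + (β₁ + ct * β)) * (1 - (β + (β₁ + ct * β)) * (R * cr) * cr)⁻¹) * cr) *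
      (1 - 1 * ((β + (β₁ + ct * β)) * (R * cr) * cr))⁻¹ := by
    have h2 : 0 ≤ (1 - 1 * ((β + (β₁ + ct * β)) * (R * cr) * cr))⁻¹ := inv_nonneg.2 (by linarith)
    positivity
  exact hasMaj_idef_comp_dressedV_loc₂_of blk π htri hd hrow hσ hcr hR ho ht hmT hA hAD hσρ₂ hρ₂V hρ₂δ T T' (fun _ => rfl) (fun _ => rfl) hunit hunit' hSχ hSψ hSχ' hSψ' hTχ
    (smoothCut_in hNψ) hTχ' (smoothCut_in hNψ') hTG' hDTG hX hDX hV hV' hDV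

end Summit.QuantumFields.YangMills.BalabanUVNodes.N15.CurvedSpecies

end
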